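/-
Copyright (c) 2026 the pub-hodgecm-mathlib formalisation cell (harness21).  Prover seat hodgecm-mathlib-F0P3-p01 (g33), Track A «(D-RAM) FOUR-FRAME», unit U2H, census leaf
(ρ2b′-X) — T5b «TORIC LEVEL CENSUS, type RamK»: (D3-LAW) part 2 — the (D3) ROW IN `hvTop` VALUE FORM, both line models, side suppliers discharged from the frame.  2026-09-04.
-/
import Summits.HodgeConjecture.HodgeConjecture.Theorems.F0P3cDyRamToricLevelCensusRamKTopLaw   -- (this seat) part 1: supplier-free top depth, the two line models in one unit; brings ★ p857901, ★ p857848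
import Summits.HodgeConjecture.HodgeConjecture.Theorems.F0P3cDyRamToricLevelCensusRamKTop      -- ★ p857836 (this lineage, g32): `ncard_levelSetDep_top_mul_eq_of_ramK` (index form, two-field RamK frame)
import Summits.HodgeConjecture.HodgeConjecture.Theorems.F0P3cDyRamToricLevelCensusUnrTopSide  -- ★ p857722 (LH4-p08 (g5)): `token_kappa`
import Literature.NumberTheory.LocalFields.WildQuadraticDatumUnitNormIndexTwo                 -- ★ `exists_unit_norm_dichotomy_of_isRamifiedQuadraticDatum` (`[Ũ : N] = 2`)
import Literature.NumberTheory.LocalFields.WildQuadraticDatumNonNormUnitLevel                 -- ★ `exists_fixed_unit_not_norm_of_level_pow` (a non-norm at level `2d − 2`)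
import Literature.NumberTheory.LocalFields.WildQuadraticDatumNormSurjective                   -- ★ `exists_mul_map_eq_of_isRamifiedQuadraticDatum` (`U_{K♮}^{(d)} ⊆ N`)
import Literature.NumberTheory.LocalFields.QuadraticDatumNormsOfDoublyFixedUnitsThirdField    -- ★ p857442 (g32): `exists_mul_map_eq_of_fixed_fixed_of_thirdField` (`𝒪_Fˣ ⊆ N`)
import Literature.NumberTheory.LocalFields.ValuedCompleteIsAdicComplete                       -- ★ `isAdicComplete_valuedInteger_of_completeSpace`
import HarnessLib

/-!
# (ρ2b′-X) T5b — (D3-LAW) type RamK, part 2: the (D3) row of the census in `hvTop` VALUE FORM (both line models)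

`Summits/HodgeConjecture/HodgeConjecture/Theorems/F0P3cDyRamToricLevelCensusRamKTopValue.lean`, namespace
`Summit.HodgeConjecture.HodgeConjecture.Cruxes.H413.F0P3cDyRamToricLevelCensusRamK` (sixth file of the T5b HEAD namespace).  PROOF FILE of a SUPPORT organ
(`--supports stmt-HodgeConjecture-24833 --as helper`; hodgecm-mathlib-F0P3-p01 (g33); socket (B) of the (ρ2b′-X) pay line, lead LH4-p07 (g7), (B-2) «WELD»).  THEOREMS ONLY.

THE ROW.  ★ p857635 `toricCensusSum_ramK` (LH4-p04 (g4)) consumes the top cells of the depth-refined census through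
`hvTop : vP j a = if 2j + d ≤ 2jλ + 1 ∧ (j + a + 2 ≤ m + 2d ∨ ε = 1) then (if j + a + 2 ≤ m + 2d then 1 else 2)·q^(j − (j+a−m+1)∕2) else 0` (and `vM` with `ε = −1`).
THIS FILE proves that sentence with GENUINE counts `vP := #levelSetDep_h`, `vM := #levelSetDep_{h′}` (`h` hyperbolic, `h′` anisotropic: the ★ (S3)(S4) letters) in the two-field
RamK frame of ★ g32, for any proposition `S` in place of `ε = 1` that agrees with the hyperbolic bit `BIT(h, μ, c₀)` at ONE far depth `c₀ ≤ D` when far cells exist: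
* §1 small z-letter lemmas: ALIVE ⇒ TOP; TOP(z·n₀) ⟺ TOP(z); TOP ⇒ ALIVE(z) ∨ ALIVE(z·n₀) (unit norm dichotomy); the token parity `jλ ≡ d (2)` is AUTOMATIC (`mod_two_eq_of_v_sub_map_eq`);
* §2 `eq_value_of_mul_idx_eq` — the ℕ-arithmetic turning ★ g32's index form `#·idxRK(q,d,c′) = |G_j|·[bit]` into the value `(1∣2)·q^(j − (c′+1)∕2)·[bit]` (`2 ≤ d`);
* §3 **`ncard_levelSetDep_top_ramK_eq`** — THE (D3) ROW, BOTH SIDES: the bit is `c′ + d ≤ jλ + 1 ∧ (c′ + 2 ≤ 2d ∨ S)` for `h` and `… ∨ ¬S` for `h′` (`c′ = j + a − m`), by part 1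
  (supplier-free top depth ★, one unit `z` for both line models ★) and ★ p857901 (near cells both sides; far cells exclusive and constant), the side suppliers `hdich`, `n₁`, `hNF`,
  `hNd` being DISCHARGED here from the frame (★ `…UnitNormIndexTwo`, ★ `…NonNormUnitLevel`, ★ p857442, ★ `…NormSurjective`).
HONEST LABEL: HC_CM is proved only modulo the 7 printed citations (2 remaining named inputs: hLiu418 = stmt-HodgeConjecture-24832, h413 = stmt-HodgeConjecture-24833) until rung 0
closes; (ρ2b′-X) is OPEN; this leaf is unconditional local algebra and count-neutral.

## References
* [Serre1979] J.-P. Serre, *Local Fields*, GTM 67 (1979): Ch. V §2 Prop. 3, §3 Prop. 5 and Cor. 3; Ch. III §6 Prop. 12; Ch. X §1.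
* [Flicker1998UnitaryFL] Y. Z. Flicker, *Elementary proof of the fundamental lemma for a unitary group*, Canad. J. Math. 50 (1998): Prop. 7 p. 84.
* [Jacobowitz1962] R. Jacobowitz, *Hermitian forms over local fields*, Amer. J. Math. 84 (1962): §4.
* [Kottwitz1986BaseChangeUnits] R. E. Kottwitz, *Base change for unit elements of Hecke algebras*, Compositio Math. 60 (1986): §1 pp. 240–241.
-/

set_option autoImplicit false

namespace Summit.HodgeConjecture.HodgeConjecture.Cruxes.H413.F0P3cDyRamToricLevelCensusRamK

open WithZero IsLocalRing
open scoped Valued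
open Literature.NumberTheory.Automorphic.UnitaryThreeFourFrame (IsRamifiedQuadraticDatum)
open Literature.NumberTheory.LocalFields.WildQuadraticDatum
open Summit.HodgeConjecture.HodgeConjecture.Cruxes.H413.F0P3cDyRamToricCensusDefs
open Summit.HodgeConjecture.HodgeConjecture.Cruxes.H413.F0P3cDyRamToricLevelCensusUnr (token_kappa)
open Summit.HodgeConjecture.HodgeConjecture.Cruxes.H413.F0P3cDyRamTopDepthRamK (v_eq_one_of_v_sub_one_le)
open Summit.HodgeConjecture.HodgeConjecture.Cruxes.H413.F0P3cDyRamTopSideRamK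

variable {K : Type} [Field K] [Valued K ℤᵐ⁰] {ρ Θ : K →+* K} {α ϖE : K}
variable {K' : Type} [Field K'] [Valued K' ℤᵐ⁰] {σ' : K' →+* K'} {α' π' : K'}   -- the third field `K' ≅ K♮ = Fix Θ`

/-! ## §1 Small z-letter lemmas -/

/-- ALIVE ⇒ TOP: a norm `xΘx` is a `Θ`-fixed unit. [cite: Serre1979, Ch. V §3] -/
theorem topDecomp_of_alive (hΘΘ : ∀ x, Θ (Θ x) = x) (hvΘ : ∀ x, Valued.v (Θ x) = Valued.v x) {z : K} {c : ℕ}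
    (halive : ∃ x e w : K, Valued.v x = 1 ∧ ρ e = e ∧ Valued.v e = 1 ∧ Valued.v (w - 1) ≤ exp (-(c : ℤ)) ∧ z = x * Θ x * e * w) :
    ∃ k e w : K, Θ k = k ∧ Valued.v k = 1 ∧ ρ e = e ∧ Valued.v e = 1 ∧ Valued.v (w - 1) ≤ exp (-(c : ℤ)) ∧ z = k * e * w := by
  obtain ⟨x, e, w, hx, hρe, hve, hw, hz⟩ := halive
  exact ⟨x * Θ x, e, w, by rw [map_mul, hΘΘ, mul_comm], by rw [Valuation.map_mul, hvΘ, hx, mul_one], hρe, hve, hw, hz⟩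

/-- TOP(z·n₀) ⟺ TOP(z) for a `Θ`-fixed unit `n₀`. [cite: Serre1979, Ch. V §3] -/
theorem topDecomp_mul_iff {z n₀ : K} (hΘn : Θ n₀ = n₀) (hn1 : Valued.v n₀ = 1) (c : ℕ) :
    (∃ k e w : K, Θ k = k ∧ Valued.v k = 1 ∧ ρ e = e ∧ Valued.v e = 1 ∧ Valued.v (w - 1) ≤ exp (-(c : ℤ)) ∧ z * n₀ = k * e * w) ↔
      ∃ k e w : K, Θ k = k ∧ Valued.v k = 1 ∧ ρ e = e ∧ Valued.v e = 1 ∧ Valued.v (w - 1) ≤ exp (-(c : ℤ)) ∧ z = k * e * w := by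
  have hn0 : n₀ ≠ 0 := fun h0 => by rw [h0, map_zero] at hn1; exact zero_ne_one hn1
  constructor
  · rintro ⟨k, e, w, hΘk, hvk, hρe, hve, hw, hz⟩
    refine ⟨k * n₀⁻¹, e, w, by rw [map_mul, map_inv₀, hΘk, hΘn], by rw [Valuation.map_mul, map_inv₀, hvk, hn1, inv_one, mul_one], hρe, hve, hw, ?_⟩
    rw [mul_assoc (k * n₀⁻¹), mul_assoc k, mul_comm n₀⁻¹, ← mul_assoc, ← mul_assoc, ← hz, mul_assoc, mul_inv_cancel₀ hn0, mul_one]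
  · rintro ⟨k, e, w, hΘk, hvk, hρe, hve, hw, hz⟩
    refine ⟨k * n₀, e, w, by rw [map_mul, hΘk, hΘn], by rw [Valuation.map_mul, hvk, hn1, mul_one], hρe, hve, hw, ?_⟩
    rw [hz]; ring

/-- At any depth, TOP ⇒ ALIVE(z) ∨ ALIVE(z·n₀) for a `Θ`-fixed unit NON-norm `n₀`: by the unit norm dichotomy (`hdich`: `u ∈ N` or `c₀u ∈ N`), `k ∉ N` forces `k·n₀ ∈ N`
(`k·n₀ = (c₀k)(c₀n₀)∕(c₀Θc₀)`). [cite: Serre1979, Ch. V §3 Cor. 3] -/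
theorem alive_or_alive_mul_of_topDecomp (hvΘ : ∀ x, Valued.v (Θ x) = Valued.v x)
    (hdich : ∃ c₀ : K, Θ c₀ = c₀ ∧ Valued.v c₀ = 1 ∧ ∀ u : K, Θ u = u → Valued.v u = 1 → (∃ x : K, x * Θ x = u) ∨ ∃ x : K, x * Θ x = c₀ * u)
    {n₀ : K} (hΘn : Θ n₀ = n₀) (hn1 : Valued.v n₀ = 1) (hnn : ¬ ∃ x : K, x * Θ x = n₀) {z : K} {c : ℕ}
    (htop : ∃ k e w : K, Θ k = k ∧ Valued.v k = 1 ∧ ρ e = e ∧ Valued.v e = 1 ∧ Valued.v (w - 1) ≤ exp (-(c : ℤ)) ∧ z = k * e * w) :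
    (∃ x e w : K, Valued.v x = 1 ∧ ρ e = e ∧ Valued.v e = 1 ∧ Valued.v (w - 1) ≤ exp (-(c : ℤ)) ∧ z = x * Θ x * e * w) ∨
      ∃ x e w : K, Valued.v x = 1 ∧ ρ e = e ∧ Valued.v e = 1 ∧ Valued.v (w - 1) ≤ exp (-(c : ℤ)) ∧ z * n₀ = x * Θ x * e * w := by
  -- `|x·Θx| = 1 ⇒ |x| = 1`
  have hunit : ∀ x f : K, x * Θ x = f → Valued.v f = 1 → Valued.v x = 1 := fun x f hxf hf =>
    v_eq_one_of_v_norm_eq_one hvΘ (by rw [hxf, hf])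
  obtain ⟨c₀, hΘc, hc1, hdich⟩ := hdich
  obtain ⟨k, e, w, hΘk, hvk, hρe, hve, hw, hz⟩ := htop
  rcases hdich k hΘk hvk with ⟨x, hx⟩ | ⟨x, hx⟩
  · exact Or.inl ⟨x, e, w, hunit x k hx hvk, hρe, hve, hw, by rw [hz, hx]⟩
  · right
    rcases hdich n₀ hΘn hn1 with ⟨y, hy⟩ | ⟨y, hy⟩
    · exact absurd ⟨y, hy⟩ hnn
    · have hc0 : c₀ ≠ 0 := fun h0 => by rw [h0, map_zero] at hc1; exact zero_ne_one hc1
      have hvx : Valued.v x = 1 := hunit x (c₀ * k) hx (by rw [Valuation.map_mul, hc1, hvk, mul_one])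
      have hvy : Valued.v y = 1 := hunit y (c₀ * n₀) hy (by rw [Valuation.map_mul, hc1, hn1, mul_one])
      refine ⟨x * y * c₀⁻¹, e, w, by rw [Valuation.map_mul, Valuation.map_mul, map_inv₀, hvx, hvy, hc1, inv_one, mul_one, mul_one], hρe, hve, hw, ?_⟩
      have hN : x * y * c₀⁻¹ * Θ (x * y * c₀⁻¹) = k * n₀ := by
        rw [map_mul, map_mul, map_inv₀, hΘc]
        have : x * Θ x * (y * Θ y) = c₀ * k * (c₀ * n₀) := by rw [hx, hy]
        field_simp
        linear_combination this
      rw [hz, hN]; ring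

/-- **THE TOKEN PARITY `jλ ≡ d (2)` IS AUTOMATIC**: for ANY `κ` with `|κ − Θκ| = exp(−jλ)` one has `jλ ≡ d (mod 2)` — `κ − Θκ = g₁·(ϖE − ΘϖE)` in `K♮`-coordinates and
`Θ`-fixed non-zero elements have even valuation.  (Discharges the `hjl` letter of ★ p857635 from the frame alone.) [cite: Serre1979, Ch. III §6 Prop. 12] -/
theorem mod_two_eq_of_v_sub_map_eq (hΘΘ : ∀ x, Θ (Θ x) = x) (hϖE : Valued.v ϖE = exp (-1 : ℤ)) {d : ℕ} (hdatum : Valued.v (ϖE - Θ ϖE) = Valued.v ϖE ^ d)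
    (hΘev : ∀ x : K, Θ x = x → x ≠ 0 → ∃ n : ℤ, Valued.v x = exp (2 * n))
    {κ : K} {jl : ℕ} (hκΘ : Valued.v (κ - Θ κ) = exp (-(jl : ℤ))) : jl % 2 = d % 2 := by
  have hΘϖ : Θ ϖE ≠ ϖE := fun h0 => by
    rw [h0, sub_self, map_zero, v_varpi_pow hϖE] at hdatum
    exact exp_ne_zero hdatum.symm
  obtain ⟨g₀, g₁, hg₀, hg₁, hκeq⟩ := Literature.NumberTheory.LocalFields.exists_fixed_coords_of_map_ne hΘΘ hΘϖ κ
  have hdiff : κ - Θ κ = g₁ * (ϖE - Θ ϖE) := by rw [hκeq, map_add, map_mul, hg₀, hg₁]; ring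
  have h1 : Valued.v g₁ * exp (-(d : ℤ)) = exp (-(jl : ℤ)) := by rw [← v_varpi_pow hϖE, ← hdatum, ← Valuation.map_mul, ← hdiff, hκΘ]
  have hg₁0 : g₁ ≠ 0 := fun h0 => by rw [h0, map_zero, zero_mul] at h1; exact exp_ne_zero h1.symm
  obtain ⟨n, hn⟩ := hΘev g₁ hg₁ hg₁0
  rw [hn, ← exp_add] at h1
  have h2 : 2 * n + -(d : ℤ) = -(jl : ℤ) := exp_injective h1
  omega

/-! ## §2 The ℕ-arithmetic of the index form -/

/-- From ★ g32's index form `N·idxRK(q,d,c) = (q+1)q^(j−1)·[bit]` (`idxRK(c) = (q+1)q^((c+1)∕2−1)` for `c + 2 ≤ 2d`, halved beyond) to the VALUE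
`N = [bit]·(1∣2)·q^(j − (c+1)∕2)` (`1 ≤ q`, `2 ≤ d`, `1 ≤ c ≤ j`). [cite: Flicker1998UnitaryFL, Prop. 7 p. 84] -/
theorem eq_value_of_mul_idx_eq {q d j c N : ℕ} (hq : 1 ≤ q) (hd2 : 2 ≤ d) (hc1 : 1 ≤ c) (hcj : c ≤ j) (bit : Prop) [Decidable bit]
    (H : N * (if c = 0 then 1 else if c + 2 ≤ 2 * d then (q + 1) * q ^ ((c + 1) / 2 - 1) else (q + 1) * q ^ ((c + 1) / 2 - 1) / 2) =
      if bit then (q + 1) * q ^ (j - 1) else 0) :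
    N = if bit then (if c + 2 ≤ 2 * d then 1 else 2) * q ^ (j - (c + 1) / 2) else 0 := by
  rw [if_neg (show c ≠ 0 by omega)] at H
  have hq0 : 0 < q := by omega
  have hk : (c + 1) / 2 - 1 + 1 = (c + 1) / 2 := by omega
  -- the full index is `(q+1)q^k ≠ 0`; beyond the threshold it is even
  have hI0 : (q + 1) * q ^ ((c + 1) / 2 - 1) ≠ 0 := mul_ne_zero (by omega) (pow_ne_zero _ hq0.ne')
  by_cases hnear : c + 2 ≤ 2 * d
  · rw [if_pos hnear] at H
    by_cases hb : bit
    · rw [if_pos hb] at H ⊢; rw [if_pos hnear, one_mul]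
      refine mul_right_cancel₀ hI0 ?_
      rw [H, mul_comm (q ^ (j - (c + 1) / 2)), mul_assoc, ← pow_add, show (c + 1) / 2 - 1 + (j - (c + 1) / 2) = j - 1 by omega]
    · rw [if_neg hb] at H ⊢
      exact (mul_eq_zero.1 H).resolve_right hI0
  · rw [if_neg hnear] at H
    -- `2 ∣ (q+1)q^k` since `k ≥ 1`
    have hk1 : 1 ≤ (c + 1) / 2 - 1 := by omega
    have heven : 2 ∣ (q + 1) * q ^ ((c + 1) / 2 - 1) := by
      rcases Nat.even_or_odd q with hqe | hqo
      · exact Dvd.dvd.mul_left (dvd_trans (even_iff_two_dvd.1 hqe) (dvd_pow_self q (by omega))) _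
      · exact Dvd.dvd.mul_right (even_iff_two_dvd.1 (Nat.even_add_one.2 (Nat.not_even_iff_odd.2 hqo))) _
    obtain ⟨M, hM⟩ := heven
    have hM0 : M ≠ 0 := fun h0 => hI0 (by rw [hM, h0, mul_zero])
    rw [hM, Nat.mul_div_cancel_left M (by norm_num)] at H
    by_cases hb : bit
    · rw [if_pos hb] at H ⊢; rw [if_neg hnear]
      refine mul_right_cancel₀ hM0 ?_
      rw [H]
      have h2 : 2 * q ^ (j - (c + 1) / 2) * M = q ^ (j - (c + 1) / 2) * (2 * M) := by ring
      rw [h2, ← hM, mul_comm (q ^ (j - (c + 1) / 2)), mul_assoc, ← pow_add, show (c + 1) / 2 - 1 + (j - (c + 1) / 2) = j - 1 by omega]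
    · rw [if_neg hb] at H ⊢
      exact (mul_eq_zero.1 H).resolve_right hM0

/-! ## §3 The (D3) row in `hvTop` value form, both line models -/

open scoped Classical in
/-- **THE (D3) ROW IN `hvTop` VALUE FORM, TYPE RamK, BOTH SIDES.**  Frame = the two-field RamK frame of ★ g32 `ncard_levelSetDep_top_mul_eq_of_ramK` (`M = K` complete with
DVR integers and residue field of size `q²`; `ρ, Θ`; `α` integral with `|α − ρα| = 1`; the ramified `Θ`-datum on the `ρ`-fixed uniformiser `ϖE`; the third field `K′` with
`σ′, α′, π′, jK`).  Data: a HYPERBOLIC `Θ`-fixed scalar `h` and an ANISOTROPIC `Θ`-fixed scalar `h′` (★ (S3)(S4) letters); the token `μ = λ − u` (`λΘλ = 1`, `ρu = u`,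
`uΘu = 1`, `|μ| = exp(−m)`, `|μ − ρμ| = exp(−jλ)`) with `m ≡ jλ (2)`; `2 ≤ d`; a proposition `S` which, if far cells exist (`3d ≤ jλ + 2`), agrees with the hyperbolic bit
`BIT(h, μ, c₀)` at SOME far depth `c₀` (`2d ≤ c₀ + 1`, `c₀ + d ≤ jλ + 1`).  Then on every top cell (`j ≤ jλ`, `1 ≤ a`, `j + m = jλ + a`, `m + 1 ≤ 2a`):
`#levelSetDep_h(j,a;μ) = if 2j + d ≤ 2jλ + 1 ∧ (j + a + 2 ≤ m + 2d ∨ S) then (if j + a + 2 ≤ m + 2d then 1 else 2)·q^(j − (j+a−m+1)∕2) else 0`, and the same for `h′` with `¬S`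
— the `hvTop` sentence of ★ p857635 with `ε = 1 ↦ S`, `ε = −1 ↦ ¬S`. [cite: Flicker1998UnitaryFL, Prop. 7 p. 84] [cite: Kottwitz1986BaseChangeUnits, §1 pp. 240–241]
[cite: Serre1979, Ch. V §3 Prop. 5, Cor. 3] [cite: Jacobowitz1962, §4] -/
theorem ncard_levelSetDep_top_ramK_eq [CompleteSpace K] [IsDiscreteValuationRing 𝒪[K]] [Finite 𝓀[K]]
    [CompleteSpace K'] [IsDiscreteValuationRing 𝒪[K']] [Finite 𝓀[K']]
    (hρρ : ∀ x, ρ (ρ x) = x) (hvρ : ∀ x, Valued.v (ρ x) = Valued.v x) (hΘρ : ∀ x, Θ (ρ x) = ρ (Θ x))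
    (hα1 : Valued.v α ≤ 1) (hα : Valued.v (α - ρ α) = 1) {d t : ℕ} (hD : IsRamifiedQuadraticDatum Θ ϖE d t) (hρϖ : ρ ϖE = ϖE)
    {q : ℕ} (hq : Nat.card 𝓀[K] = q ^ 2)
    (hσ' : ∀ x, σ' (σ' x) = x) (hvσ' : ∀ x, Valued.v (σ' x) = Valued.v x) (hα'1 : Valued.v α' ≤ 1) (hα' : Valued.v (α' - σ' α') = 1)
    (hπ' : Valued.v π' = exp (-1 : ℤ)) (hq' : Nat.card 𝓀[K'] = q ^ 2)
    (jK : K' →+* K) (hjv : ∀ x, Valued.v (jK x) = Valued.v x ^ 2) (hjΘ : ∀ x, Θ (jK x) = jK x) (hjfix : ∀ z : K, Θ z = z → ∃ x, jK x = z)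
    (hjσ : ∀ x, jK (σ' x) = ρ (jK x))
    {h h' : K} (hΘh : Θ h = h) (hh : h ≠ 0) (hhyper : ∃ x : K, x ≠ 0 ∧ h * Θ x * x + ρ (h * Θ x * x) = 0)
    (hΘh' : Θ h' = h') (hh' : h' ≠ 0) (haniso : ¬ ∃ x : K, x ≠ 0 ∧ h' * Θ x * x + ρ (h' * Θ x * x) = 0)
    {lam u : K} (hlam : lam * Θ lam = 1) (hu : ρ u = u) (hu1 : u * Θ u = 1)
    {m jl : ℕ} (hm : Valued.v (lam - u) = exp (-(m : ℤ))) (hjl : Valued.v ((lam - u) - ρ (lam - u)) = exp (-(jl : ℤ)))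
    (hmjl : m % 2 = jl % 2) (hd2 : 2 ≤ d)
    {S : Prop} (hS : 3 * d ≤ jl + 2 → ∃ c₀ : ℕ, 2 * d ≤ c₀ + 1 ∧ c₀ + d ≤ jl + 1 ∧
      (S ↔ ∃ ω₁ : Kˣ, Valued.v (ω₁ : K) = 1 ∧
        Valued.v (1 + ρ h / h / (ρ (lam - u) / (lam - u)) * (ρ ((ω₁ : K) * Θ ω₁) / ((ω₁ : K) * Θ ω₁))) ≤ exp (-(c₀ : ℤ))))
    {j a : ℕ} (hj : j ≤ jl) (ha : 1 ≤ a) (hdiag : j + m = jl + a) (htop : m + 1 ≤ 2 * a) :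
    ((levelSetDep ρ Θ α ϖE h j a (lam - u)).ncard =
      if 2 * j + d ≤ 2 * jl + 1 ∧ (j + a + 2 ≤ m + 2 * d ∨ S) then (if j + a + 2 ≤ m + 2 * d then 1 else 2) * q ^ (j - (j + a - m + 1) / 2) else 0) ∧
    ((levelSetDep ρ Θ α ϖE h' j a (lam - u)).ncard =
      if 2 * j + d ≤ 2 * jl + 1 ∧ (j + a + 2 ≤ m + 2 * d ∨ ¬ S) then (if j + a + 2 ≤ m + 2 * d then 1 else 2) * q ^ (j - (j + a - m + 1) / 2) else 0) := by
  classical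
  -- ## the datum's clauses
  have hΘΘ : ∀ x, Θ (Θ x) = x := hD.1
  have hvΘ : ∀ x, Valued.v (Θ x) = Valued.v x := hD.2.1
  have hϖE : Valued.v ϖE = exp (-1 : ℤ) := hD.2.2.1
  have hΘev : ∀ x : K, Θ x = x → x ≠ 0 → ∃ n : ℤ, Valued.v x = exp (2 * n) := hD.2.2.2.1
  have hdatum : Valued.v (ϖE - Θ ϖE) = Valued.v ϖE ^ d := hD.2.2.2.2.1
  have hd1 : 1 ≤ d := hD.2.2.2.2.2.1
  have hρΘ : ∀ x, ρ (Θ x) = Θ (ρ x) := fun x => (hΘρ x).symm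
  have hΘϖ : Θ ϖE ≠ ϖE := fun h0 => by
    rw [h0, sub_self, map_zero, v_varpi_pow hϖE] at hdatum
    exact exp_ne_zero hdatum.symm
  haveI : IsAdicComplete 𝓂[K] 𝒪[K] := Literature.NumberTheory.LocalFields.isAdicComplete_valuedInteger_of_completeSpace hϖE
  have hq1 : 1 ≤ q := by
    by_contra h0
    have h1 : Nat.card 𝓀[K] = 0 := by rw [hq]; simp [show q = 0 by omega]
    exact (Nat.card_pos (α := 𝓀[K])).ne' h1
  -- ## the Θ-fixed unramified generator `αK := jK α′`
  have hΘαK : Θ (jK α') = jK α' := hjΘ α'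
  have hαK1 : Valued.v (jK α') ≤ 1 := by rw [hjv]; exact pow_le_one' hα'1 _
  have hαKρ : Valued.v (jK α' - ρ (jK α')) = 1 := by rw [← hjσ, ← map_sub, hjv, hα', one_pow]
  -- ## the token
  obtain ⟨hκ1, hκ, -, hκΘ, hmjl'⟩ := token_kappa hρρ hvρ hΘρ hvΘ hlam hu hu1 hm hjl
  have hμ0 : lam - u ≠ 0 := fun h0 => by rw [h0, map_zero] at hm; exact (exp_ne_zero hm.symm).elim
  -- ## one unit for both line models
  obtain ⟨z, n₀, hz1, hκz, hΘn, hn1, hnn, hBz, hBz'⟩ :=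
    exists_unit_of_lineModels hρρ hΘΘ hΘρ hvρ hvΘ hϖE hρϖ hΘev hαK1 hαKρ hΘh hh hhyper hΘh' hh' haniso hμ0
  -- ## the side suppliers, discharged from the frame
  have hNF : ∀ f : K, ρ f = f → Θ f = f → Valued.v f = 1 → ∃ x : K, x * Θ x = f := fun f hρf hΘf hf =>
    exists_mul_map_eq_of_fixed_fixed_of_thirdField hρρ hvρ hΘρ hD hσ' hvσ' hα'1 hα' hπ' jK hjv hjΘ hjfix hjσ hρf hΘf hf
  have hNd : ∀ u : K, Θ u = u → Valued.v (u - 1) ≤ Valued.v ϖE ^ (2 * d) → ∃ x : K, x * Θ x = u := fun u hΘu hu =>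
    let ⟨x, hx, _⟩ := exists_mul_map_eq_of_isRamifiedQuadraticDatum Θ ϖE d t hD u hΘu hu
    ⟨x, hx⟩
  have hdich : ∃ c₀ : K, Θ c₀ = c₀ ∧ Valued.v c₀ = 1 ∧ ∀ u : K, Θ u = u → Valued.v u = 1 → (∃ x : K, x * Θ x = u) ∨ ∃ x : K, x * Θ x = c₀ * u :=
    exists_unit_norm_dichotomy_of_isRamifiedQuadraticDatum Θ ϖE d t hD
  obtain ⟨n₁, hΘn₁, hn₁1, hn₁le, hn₁n⟩ := exists_fixed_unit_not_norm_of_level_pow Θ ϖE d t hD (n := d - 1) (by omega)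
  have hn₁c : ∀ c : ℕ, c + 2 ≤ 2 * d → Valued.v (n₁ - 1) ≤ exp (-(c : ℤ)) := fun c hc => by
    refine hn₁le.trans ?_
    rw [Valuation.map_pow, v_varpi_pow hϖE, exp_le_exp]; omega
  -- ## the cell's depth `c′ = j + a − m`
  have haj : a ≤ j := by omega
  have ham : a ≤ m := by omega
  have hpar : (j + a) % 2 = 0 := by omega
  obtain ⟨c', hc'⟩ : ∃ c' : ℕ, c' = j + a - m := ⟨_, rfl⟩
  have hc'1 : 1 ≤ c' := by omega
  have hc'j : c' ≤ j := by omega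
  have hrad : (-((j + a : ℕ) - (m : ℤ))) = -((c' : ℕ) : ℤ) := by rw [hc']; push_cast; omega
  have htopIff : ∀ c : ℕ, 1 ≤ c →
      ((∃ k e w : K, Θ k = k ∧ Valued.v k = 1 ∧ ρ e = e ∧ Valued.v e = 1 ∧ Valued.v (w - 1) ≤ exp (-(c : ℤ)) ∧ z = k * e * w) ↔ c + d ≤ jl + 1) :=
    fun c hc => exists_topDecomp_iff_le hρρ hΘΘ hΘρ hvρ hvΘ hϖE hρϖ hdatum hΘev hΘαK hαK1 hαKρ hz1 hκz hκΘ hc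
  -- ## THE LAW at depth `c′`, hyperbolic side: ALIVE(z,c′) ⟺ c′ + d ≤ jl + 1 ∧ (c′ + 2 ≤ 2d ∨ S)
  have hLawP : (∃ x e w : K, Valued.v x = 1 ∧ ρ e = e ∧ Valued.v e = 1 ∧ Valued.v (w - 1) ≤ exp (-(c' : ℤ)) ∧ z = x * Θ x * e * w) ↔
      (c' + d ≤ jl + 1 ∧ (c' + 2 ≤ 2 * d ∨ S)) := by
    constructor
    · intro hal
      have hcd : c' + d ≤ jl + 1 := (htopIff c' hc'1).1 (topDecomp_of_alive hΘΘ hvΘ hal)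
      refine ⟨hcd, ?_⟩
      by_cases hnear : c' + 2 ≤ 2 * d
      · exact Or.inl hnear
      · right
        obtain ⟨c₀, hc₀far, hc₀D, hSc₀⟩ := hS (by omega)
        have hal₀ : ∃ x e w : K, Valued.v x = 1 ∧ ρ e = e ∧ Valued.v e = 1 ∧ Valued.v (w - 1) ≤ exp (-(c₀ : ℤ)) ∧ z = x * Θ x * e * w := by
          rcases le_total c₀ c' with h01 | h10
          · exact alive_mono h01 hal
          · exact alive_of_alive_of_topDecomp hΘΘ hρΘ hvΘ hϖE hρϖ hΘϖ hΘev hd1 hNF hNd (by omega) h10 hal ((htopIff c₀ (by omega)).2 hc₀D)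
        exact hSc₀.2 ((hBz c₀ (by omega)).2 hal₀)
    · rintro ⟨hcd, hside⟩
      have htop' := (htopIff c' hc'1).2 hcd
      by_cases hnear : c' + 2 ≤ 2 * d
      · exact alive_of_topDecomp_of_nonNorm_near hvΘ hdich hΘn₁ hn₁1 hn₁n (hn₁c c' hnear) htop'
      · have hSv : S := hside.resolve_left hnear
        obtain ⟨c₀, hc₀far, hc₀D, hSc₀⟩ := hS (by omega)
        have hal₀ := (hBz c₀ (by omega)).1 (hSc₀.1 hSv)
        rcases le_total c' c₀ with h01 | h10
        · exact alive_mono h01 hal₀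
        · exact alive_of_alive_of_topDecomp hΘΘ hρΘ hvΘ hϖE hρϖ hΘϖ hΘev hd1 hNF hNd hc₀far h10 hal₀ htop'
  -- ## THE LAW at depth `c′`, anisotropic side: ALIVE(z·n₀,c′) ⟺ c′ + d ≤ jl + 1 ∧ (c′ + 2 ≤ 2d ∨ ¬S)
  have hLawM : (∃ x e w : K, Valued.v x = 1 ∧ ρ e = e ∧ Valued.v e = 1 ∧ Valued.v (w - 1) ≤ exp (-(c' : ℤ)) ∧ z * n₀ = x * Θ x * e * w) ↔
      (c' + d ≤ jl + 1 ∧ (c' + 2 ≤ 2 * d ∨ ¬ S)) := by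
    have hexcl : ∀ (h₁ : ∃ x e w : K, Valued.v x = 1 ∧ ρ e = e ∧ Valued.v e = 1 ∧ Valued.v (w - 1) ≤ exp (-(c' : ℤ)) ∧ z = x * Θ x * e * w)
        (h₂ : ∃ x e w : K, Valued.v x = 1 ∧ ρ e = e ∧ Valued.v e = 1 ∧ Valued.v (w - 1) ≤ exp (-(c' : ℤ)) ∧ z * n₀ = x * Θ x * e * w),
        2 * d ≤ c' + 1 → False := fun h₁ h₂ hfar => by
      refine not_alive_and_alive_mul_nonNorm hΘΘ hρΘ hvΘ hϖE hρϖ hΘϖ hΘev hd1 hNF hNd hΘn hnn (map_one ρ) (Valuation.map_one _) hfar h₁ ?_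
      obtain ⟨x, e, w, hx, hρe, hve, hw, hzz⟩ := h₂
      exact ⟨x, e, w, hx, hρe, hve, hw, by rw [mul_one, hzz]⟩
    constructor
    · intro hal
      have htop' := (topDecomp_mul_iff (ρ := ρ) hΘn hn1 c').1 (topDecomp_of_alive hΘΘ hvΘ hal)
      have hcd : c' + d ≤ jl + 1 := (htopIff c' hc'1).1 htop'
      refine ⟨hcd, ?_⟩
      by_cases hnear : c' + 2 ≤ 2 * d
      · exact Or.inl hnear
      · right
        intro hSv
        exact hexcl (hLawP.2 ⟨hcd, Or.inr hSv⟩) hal (by omega)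
    · rintro ⟨hcd, hside⟩
      have htop' := (htopIff c' hc'1).2 hcd
      by_cases hnear : c' + 2 ≤ 2 * d
      · exact alive_of_topDecomp_of_nonNorm_near hvΘ hdich hΘn₁ hn₁1 hn₁n (hn₁c c' hnear) ((topDecomp_mul_iff (ρ := ρ) hΘn hn1 c').2 htop')
      · have hnS : ¬ S := hside.resolve_left hnear
        rcases alive_or_alive_mul_of_topDecomp (ρ := ρ) hvΘ hdich hΘn hn1 hnn htop' with hP | hM
        · exact absurd ((hLawP.1 hP).2.resolve_left hnear) hnS
        · exact hM
  -- ## ★ g32's index form for both scalars, the bit closed, the arithmetic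
  have GP := ncard_levelSetDep_top_mul_eq_of_ramK hρρ hvρ hΘρ hα1 hα hD hρϖ hΘh hh hq hσ' hvσ' hα'1 hα' hπ' hq' jK hjv hjΘ hjfix hjσ
    hm hjl ha haj ham hdiag htop hpar
  have GM := ncard_levelSetDep_top_mul_eq_of_ramK hρρ hvρ hΘρ hα1 hα hD hρϖ hΘh' hh' hq hσ' hvσ' hα'1 hα' hπ' hq' jK hjv hjΘ hjfix hjσ
    hm hjl ha haj ham hdiag htop hpar
  rw [hrad] at GP GM
  rw [← hc'] at GP GM ⊢
  have hBP : (∃ ω₁ : Kˣ, Valued.v (ω₁ : K) = 1 ∧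
      Valued.v (1 + ρ h / h / (ρ (lam - u) / (lam - u)) * (ρ ((ω₁ : K) * Θ ω₁) / ((ω₁ : K) * Θ ω₁))) ≤ exp (-(c' : ℤ))) ↔
      (2 * j + d ≤ 2 * jl + 1 ∧ (j + a + 2 ≤ m + 2 * d ∨ S)) := by
    rw [hBz c' hc'1, hLawP]; constructor <;> rintro ⟨h1, h2⟩ <;> refine ⟨by omega, h2.imp (by omega) id⟩
  have hBM : (∃ ω₁ : Kˣ, Valued.v (ω₁ : K) = 1 ∧
      Valued.v (1 + ρ h' / h' / (ρ (lam - u) / (lam - u)) * (ρ ((ω₁ : K) * Θ ω₁) / ((ω₁ : K) * Θ ω₁))) ≤ exp (-(c' : ℤ))) ↔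
      (2 * j + d ≤ 2 * jl + 1 ∧ (j + a + 2 ≤ m + 2 * d ∨ ¬ S)) := by
    rw [hBz' c' hc'1, hLawM]; constructor <;> rintro ⟨h1, h2⟩ <;> refine ⟨by omega, h2.imp (by omega) id⟩
  have hnearIff : c' + 2 ≤ 2 * d ↔ j + a + 2 ≤ m + 2 * d := by omega
  constructor
  · have H := eq_value_of_mul_idx_eq hq1 hd2 hc'1 hc'j _ (by rw [ite_congr (propext hBP) (fun _ => rfl) (fun _ => rfl)] at GP; exact GP)
    rw [H]; simp only [hnearIff]
  · have H := eq_value_of_mul_idx_eq hq1 hd2 hc'1 hc'j _ (by rw [ite_congr (propext hBM) (fun _ => rfl) (fun _ => rfl)] at GM; exact GM)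
    rw [H]; simp only [hnearIff]

end Summit.HodgeConjecture.HodgeConjecture.Cruxes.H413.F0P3cDyRamToricLevelCensusRamK
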